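import Summits.BirchSwinnertonDyer.BirchSwinnertonDyer.Theorems.GenusKolyvaginAtTwoPowDvdShaCardAtTwoRTAuxiliaryClassAllPlacesCount
import Summits.BirchSwinnertonDyer.BirchSwinnertonDyer.Theorems.SchneiderFreeAdditiveX3PoitouTateSelmerComplementCanonical
import Summits.BirchSwinnertonDyer.BirchSwinnertonDyer.Theorems.SchneiderFreeAdditiveX3PoitouTateReciprocitySumHolds
import Literature.NumberTheory.EllipticCurves.McCallumAuxiliaryClass
import HarnessLib

/-!
# Route `GenusKolyvaginAtTwo`, LINES 18/19 (L_T stmt-BirchSwinnertonDyer-23242, L⁺_T stmt-23379), step (b) input I5, all places: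
# McCALLUM 1991 PROP. 2.1 FOR EVERY NUMBER FIELD AT EVERY PRIME-POWER LEVEL, ALL PLACES — the prime-power case of the named fact
# `McCallum1991_prop_2_1_auxiliaryClass` is a THEOREM

Width seat `bsd-line-gk2-p4` g16 (cell `bsd-f1-sign2`), `--supports stmt-BirchSwinnertonDyer-23242` (helper; closes nothing).
THEOREMS ONLY: no definition, no named fact, no `sorry`; standard axioms.  BSD is NOT proved by any of this.
Sequel of `…RTAuxiliaryClassAllPlacesCount.lean` (the count over any finite set of places).

WHAT (namespace `…Theorems.GenusExact.AuxiliaryClass`):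
* **`exists_ne_zero_mem_kummerOutside_places`** — Prop. 2.1 with `S : Finset (Place K)`, `w : Place K` (any kinds of places), over
  the displayed inputs (`IsPerfect`, `SumLocalTermEqZero`, `SelmerComplement`, Tate's count at finite places, `inv` injective at the
  real places): `1 < #H¹(K_w, E[p^k])`, `#H_v² = #H¹(K_v, E[p^k])` on `S` ⟹ `∃ c ∈ kummerOutside W (p^k) (insert w S), c ≠ 0 ∧
  ∀ v ∈ S, loc_v c ∈ H_v` (McCallum's pigeonhole on `natCard_map_kummerOutside_sq_places`).
* **`mcCallum1991_prop_2_1_auxiliaryClass_primePow`** — UNCONDITIONAL, for EVERY number field `K`: the body of gk2-p2's named fact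
  `Literature.NumberTheory.EllipticCurves.McCallum1991_prop_2_1_auxiliaryClass K` with its level binder specialised to `m = p^k`
  (`p` prime, `k ≥ 1`), all other binders verbatim (THE canonical family of local invariant maps: `canonical_isPerfect`,
  `sumLocalTermEqZero_canonical`, `selmerComplement_canonical_holds`, `archimedeanInvariantMap_injective_of_isReal`; Tate's count
  `localEulerPoincareCharacteristic_holds`; Weil pairing `exists_weilPairing_holds`).
* `mcCallum_prop_2_1_primePow_of_fact'` — sanity: the fact specialises to it.
What remains of the fact: composite levels `m` only.  BSD is NOT proved by any of this.

References: [McCallumLMS1991] §2 Prop. 2.1; [MilneADT2006] Ch. I Cor. 2.3, Thm. 2.8, Thm. 2.13, Thm. 4.10(b), Ex. 1.6(c);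
[Howard2004HeegnerKolyvagin] Thm. 2.1.11.
-/

set_option autoImplicit false
-- the Theorems namespace of this sub repeats the summit name by design (D-0017 nested layout)
set_option linter.dupNamespace false

noncomputable section

open scoped Classical

open CategoryTheory Field NumberField IsDedekindDomain Function
open Literature.NumberTheory.EllipticCurves
open Literature.NumberTheory.GaloisRepresentations
open Literature.NumberTheory.GaloisRepresentations.DiscreteGaloisModule (SelmerStructure)
open Literature.NumberTheory.GaloisCohomology
open Summit.BirchSwinnertonDyer.Rank1Residual.X11b.KummerPT
open Summit.BirchSwinnertonDyer.Rank1Residual.X11b.FiniteDuality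
open Summit.BirchSwinnertonDyer.Rank1Residual.X11b.Relaxation
open Summit.BirchSwinnertonDyer.Rank1Residual.X11b.LocBridge Summit.BirchSwinnertonDyer.Rank1Residual.X11b.Levels
open Summit.BirchSwinnertonDyer.Rank1Residual.X11b.AcSelmer
open scoped ContRepresentation

namespace Summit.BirchSwinnertonDyer.BirchSwinnertonDyer.Theorems.GenusExact.AuxiliaryClass

open Summit.BirchSwinnertonDyer.BirchSwinnertonDyer.Theorems.GenusKolyKramer (finite_galoisCohomology_toLocal)

section Kummer

variable {K : Type} [Field K] [NumberField K] (W : WeierstrassCurve K) [W.IsElliptic] (p k : ℕ)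
  [Fact p.Prime] [Finite (W.geomTorsion ((p ^ k : ℕ) : ℤ))]

variable (e : W.geomTorsion ((p ^ k : ℕ) : ℤ) → W.geomTorsion ((p ^ k : ℕ) : ℤ) → AlgebraicClosure K)
  (hμ : ∀ S T, e S T ^ (p ^ k) = 1)
  (hadd₁ : ∀ S₁ S₂ T, e (S₁ + S₂) T = e S₁ T * e S₂ T)
  (hadd₂ : ∀ S T₁ T₂, e S (T₁ + T₂) = e S T₁ * e S T₂)
  (hgal : ∀ (σ : absoluteGaloisGroup K) (S T : W.geomTorsion ((p ^ k : ℕ) : ℤ)),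
    σ • e S T = e (σ • S) (σ • T))
  (halt : ∀ T, e T T = 1) (hnondeg : ∀ T, (∀ S, e S T = 1) → T = 0)

include e hμ hadd₁ hadd₂ hgal halt hnondeg in
/-- **McCallum 1991, Prop. 2.1 with `S`, `w` ANY places of ANY number field** (displayed inputs + injectivity at the real places):
`w ∉ S` with `1 < #H¹(K_w, E[p^k])`, `#H_v² = #H¹(K_v, E[p^k])` (`v ∈ S`) ⟹ `∃ c ∈ kummerOutside W (p^k) (insert w S), c ≠ 0 ∧
∀ v ∈ S, loc_v c ∈ H_v`. [cite: McCallumLMS1991, §2 Prop. 2.1] -/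
theorem exists_ne_zero_mem_kummerOutside_places
    {inv : LocalInvariants K (p ^ k)} (hperf : inv.IsPerfect) (hsum : inv.SumLocalTermEqZero)
    (hcompl : inv.SelmerComplement)
    (hEuler : ∀ v : HeightOneSpectrum (𝓞 K),
      Nat.card (galoisCohomology ((W.torsionGaloisModule ((p ^ k : ℕ) : ℤ)).toLocal (Sum.inr v)) 1) =
        (Nat.card (nsmulAddMonoidHom (p ^ k) :
            (W.baseChange (v.adicCompletion K)).toAffine.Point →+ _).ker *
          Nat.card (v.adicCompletionIntegers K ⧸
            Ideal.span {((p ^ k : ℕ) : v.adicCompletionIntegers K)})) ^ 2)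
    (hreal : ∀ w : InfinitePlace K, w.IsReal → Injective (inv (Sum.inl w)))
    (S : Finset (Place K)) (w : Place K) (hwS : w ∉ S)
    (hw : 1 < Nat.card (galoisCohomology ((W.torsionGaloisModule ((p ^ k : ℕ) : ℤ)).toLocal w) 1))
    (H : ∀ v : Place K, AddSubgroup (galoisCohomology ((W.torsionGaloisModule ((p ^ k : ℕ) : ℤ)).toLocal v) 1))
    (hH : ∀ v ∈ S, Nat.card (H v) ^ 2 = Nat.card (galoisCohomology ((W.torsionGaloisModule ((p ^ k : ℕ) : ℤ)).toLocal v) 1)) :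
    ∃ c ∈ kummerOutside W (p ^ k) (insert w S), c ≠ 0 ∧
      ∀ v ∈ S, galoisCohomology.localization (W.torsionGaloisModule ((p ^ k : ℕ) : ℤ)) v 1 c ∈ H v := by
  classical
  obtain ⟨loc, hloc⟩ : ∃ loc : galoisCohomology (W.torsionGaloisModule ((p ^ k : ℕ) : ℤ)) 1 →+
      (∀ u : ↥(insert w S), galoisCohomology ((W.torsionGaloisModule ((p ^ k : ℕ) : ℤ)).toLocal (u : Place K)) 1),
      ∀ c u, loc c u = galoisCohomology.localization (W.torsionGaloisModule ((p ^ k : ℕ) : ℤ)) (u : Place K) 1 c :=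
    ⟨AddMonoidHom.pi fun u ↦ galoisCohomology.localization (W.torsionGaloisModule ((p ^ k : ℕ) : ℤ)) (u : Place K) 1,
      fun c u ↦ rfl⟩
  obtain ⟨G, hG⟩ : ∃ G : AddSubgroup (∀ u : ↥(insert w S), galoisCohomology
      ((W.torsionGaloisModule ((p ^ k : ℕ) : ℤ)).toLocal (u : Place K)) 1), G = (kummerOutside W (p ^ k) (insert w S)).map loc :=
    ⟨_, rfl⟩
  haveI hfin : ∀ u : Place K, Finite (galoisCohomology ((W.torsionGaloisModule ((p ^ k : ℕ) : ℤ)).toLocal u) 1) :=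
    fun u ↦ finite_galoisCohomology_toLocal W (p ^ k) u
  haveI : Finite (∀ u : ↥(insert w S), galoisCohomology ((W.torsionGaloisModule ((p ^ k : ℕ) : ℤ)).toLocal (u : Place K)) 1) :=
    Pi.finite
  have hGsq : Nat.card G ^ 2 = Nat.card (galoisCohomology ((W.torsionGaloisModule ((p ^ k : ℕ) : ℤ)).toLocal w) 1) *
      ∏ v ∈ S, Nat.card (galoisCohomology ((W.torsionGaloisModule ((p ^ k : ℕ) : ℤ)).toLocal v) 1) := by
    rw [hG, natCard_map_kummerOutside_sq_places W p k e hμ hadd₁ hadd₂ hgal halt hnondeg hperf hsum hcompl hEuler hreal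
      (insert w S) loc hloc, Finset.prod_insert hwS]
  have hq : ∀ v ∈ S, Nat.card (galoisCohomology ((W.torsionGaloisModule ((p ^ k : ℕ) : ℤ)).toLocal v) 1 ⧸ H v) =
      Nat.card (H v) := by
    intro v hv
    have h1 := AddSubgroup.card_eq_card_quotient_mul_card_addSubgroup (H v)
    have h2 := hH v hv
    have hpos : 0 < Nat.card (H v) := Nat.card_pos
    apply Nat.eq_of_mul_eq_mul_right hpos
    rw [← h1, ← h2, sq]
  obtain ⟨π, hπ⟩ : ∃ π : (∀ u : ↥(insert w S), galoisCohomology ((W.torsionGaloisModule ((p ^ k : ℕ) : ℤ)).toLocal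
      (u : Place K)) 1) →+ (∀ v : ↥S, galoisCohomology ((W.torsionGaloisModule ((p ^ k : ℕ) : ℤ)).toLocal (v : Place K)) 1 ⧸ H v),
      ∀ x v, π x v = QuotientAddGroup.mk (x ⟨v, Finset.mem_insert_of_mem v.2⟩) :=
    ⟨AddMonoidHom.pi fun v : ↥S ↦ (QuotientAddGroup.mk' (H v)).comp
      (Pi.evalAddMonoidHom (fun u : ↥(insert w S) ↦ galoisCohomology
        ((W.torsionGaloisModule ((p ^ k : ℕ) : ℤ)).toLocal (u : Place K)) 1) ⟨v, Finset.mem_insert_of_mem v.2⟩),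
      fun x v ↦ rfl⟩
  have hnotinj : ¬ Injective (π.comp G.subtype) := by
    intro hinj
    haveI : Finite (∀ v : ↥S, galoisCohomology ((W.torsionGaloisModule ((p ^ k : ℕ) : ℤ)).toLocal (v : Place K)) 1 ⧸ H v) :=
      Pi.finite
    have hle : Nat.card G ≤ ∏ v ∈ S, Nat.card (H v) := by
      have h := Nat.card_le_card_of_injective _ hinj
      rw [Nat.card_pi, Finset.prod_coe_sort S fun v ↦ Nat.card (galoisCohomology
        ((W.torsionGaloisModule ((p ^ k : ℕ) : ℤ)).toLocal v) 1 ⧸ H v)] at h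
      exact h.trans (Finset.prod_congr rfl hq).le
    have hprod : ∏ v ∈ S, Nat.card (galoisCohomology ((W.torsionGaloisModule ((p ^ k : ℕ) : ℤ)).toLocal v) 1) =
        (∏ v ∈ S, Nat.card (H v)) ^ 2 := by
      rw [← Finset.prod_pow]
      exact Finset.prod_congr rfl fun v hv ↦ (hH v hv).symm
    have hXpos : 0 < (∏ v ∈ S, Nat.card (H v)) ^ 2 :=
      pow_pos (Finset.prod_pos fun v _ ↦ (Nat.card_pos (α := H v))) 2
    have h1 : Nat.card G ^ 2 ≤ (∏ v ∈ S, Nat.card (H v)) ^ 2 := Nat.pow_le_pow_left hle 2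
    rw [hGsq, hprod] at h1
    have h3 := Nat.mul_le_mul_right ((∏ v ∈ S, Nat.card (H v)) ^ 2) hw
    omega
  rw [injective_iff_map_eq_zero] at hnotinj
  push Not at hnotinj
  obtain ⟨⟨g, hgG⟩, hg0, hgne⟩ := hnotinj
  rw [hG] at hgG
  obtain ⟨c, hc, hcg⟩ := hgG
  refine ⟨c, hc, ?_, fun v hv ↦ ?_⟩
  · rintro rfl
    apply hgne
    apply Subtype.ext
    change g = 0
    rw [← hcg, map_zero]
  · have h := congr_fun hg0 ⟨v, hv⟩
    change π g ⟨v, hv⟩ = 0 at h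
    rw [hπ, QuotientAddGroup.eq_zero_iff, ← hcg, hloc] at h
    exact h

omit [Finite (W.geomTorsion ((p ^ k : ℕ) : ℤ))] in
/-- **THE PRIME-POWER CASE OF THE NAMED FACT `McCallum1991_prop_2_1_auxiliaryClass`, FOR EVERY NUMBER FIELD — UNCONDITIONAL.**
The body of `Literature.NumberTheory.EllipticCurves.McCallum1991_prop_2_1_auxiliaryClass K` (gk2-p2 p687525) with its level binder
`m, 1 < m` specialised to `m = p^k` (`p` prime, `0 < k`), ALL other binders verbatim (`w`, `S`, `H` over all places of `K`, real and
complex included).  Inputs, all tree theorems: THE canonical family of local invariant maps (`LocalInvariants.canonical_isPerfect`,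
`SchneiderFreeAdditiveX3.PoitouTateReduction.sumLocalTermEqZero_canonical` / `selmerComplement_canonical_holds`, injective at the
real places by `archimedeanInvariantMap_injective_of_isReal`), Tate's local Euler characteristic
(`localEulerPoincareCharacteristic_holds`), the Weil pairing (`exists_weilPairing_holds`), finiteness of `E[p^k]`.
[cite: McCallumLMS1991, §2 Prop. 2.1] [cite: MilneADT2006, Ch. I, Thm. 2.8, Thm. 2.13, Thm. 4.10(b) and Ex. 1.6(c)] -/
theorem mcCallum1991_prop_2_1_auxiliaryClass_primePow (hk : 0 < k) (w : Place K)
    (hw : ∃ x : galoisCohomology ((W.torsionGaloisModule ((p ^ k : ℕ) : ℤ)).toLocal w) 1, x ≠ 0)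
    (S : Finset (Place K)) (hwS : w ∉ S)
    (H : ∀ v : Place K, AddSubgroup (galoisCohomology ((W.torsionGaloisModule ((p ^ k : ℕ) : ℤ)).toLocal v) 1))
    (hH : ∀ v ∈ S, Nat.card (H v) * Nat.card (H v) =
      Nat.card (galoisCohomology ((W.torsionGaloisModule ((p ^ k : ℕ) : ℤ)).toLocal v) 1)) :
    ∃ c : galoisCohomology (W.torsionGaloisModule ((p ^ k : ℕ) : ℤ)) 1, c ≠ 0 ∧
      (∀ v : Place K, v ∉ S → v ≠ w →
        galoisCohomology.localization (W.torsionGaloisModule ((p ^ k : ℕ) : ℤ)) v 1 c ∈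
          W.kummerSelmerStructure ((p ^ k : ℕ) : ℤ) v) ∧
      (∀ v ∈ S, galoisCohomology.localization (W.torsionGaloisModule ((p ^ k : ℕ) : ℤ)) v 1 c ∈ H v) := by
  have hprime : p.Prime := Fact.out
  have hpp : IsPrimePow (p ^ k) := ⟨p, k, hprime.prime, hk, rfl⟩
  have hp2 : 2 ≤ p ^ k := le_trans hprime.two_le (Nat.le_self_pow hk.ne' p)
  have hchar : ((p ^ k : ℕ) : K) ≠ 0 := Nat.cast_ne_zero.mpr (pow_ne_zero _ hprime.ne_zero)
  haveI : Finite (W.geomTorsion ((p ^ k : ℕ) : ℤ)) := finite_geomTorsion_pow W p k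
  haveI := finite_galoisCohomology_toLocal W (p ^ k) w
  obtain ⟨e, hμ, hadd₁, hadd₂, halt, hnondeg, hgal⟩ := W.exists_weilPairing_holds (p ^ k) hp2 hchar
  have hperf := LocalInvariants.canonical_isPerfect (K := K) (n := p ^ k)
  have hsum := Summit.BirchSwinnertonDyer.BirchSwinnertonDyer.Theorems.SchneiderFreeAdditiveX3.PoitouTateReduction.sumLocalTermEqZero_canonical
    (K := K) (p ^ k)
  have hcompl := Summit.BirchSwinnertonDyer.BirchSwinnertonDyer.Theorems.SchneiderFreeAdditiveX3.PoitouTateReduction.selmerComplement_canonical_holds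
    K (p ^ k)
  have hreal : ∀ w' : InfinitePlace K, w'.IsReal →
      Injective (LocalInvariants.canonical K (p ^ k) (Sum.inl w')) := fun w' hw' ↦ by
    rw [LocalInvariants.canonical_inl]
    exact archimedeanInvariantMap_injective_of_isReal hw'
  have hEuler : ∀ v : HeightOneSpectrum (𝓞 K),
      Nat.card (galoisCohomology ((W.torsionGaloisModule ((p ^ k : ℕ) : ℤ)).toLocal (Sum.inr v)) 1) =
        (Nat.card (nsmulAddMonoidHom (p ^ k) :
            (W.baseChange (v.adicCompletion K)).toAffine.Point →+ _).ker *
          Nat.card (v.adicCompletionIntegers K ⧸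
            Ideal.span {((p ^ k : ℕ) : v.adicCompletionIntegers K)})) ^ 2 := fun v ↦ by
    haveI : CharZero (v.adicCompletion K) := charZero_adicCompletion v
    exact natCard_galoisCohomology_one_torsion_adicCompletion_eq_sq W v (p ^ k) hpp
      (localEulerPoincareCharacteristic_holds (v.adicCompletion K))
  have hw' : 1 < Nat.card (galoisCohomology ((W.torsionGaloisModule ((p ^ k : ℕ) : ℤ)).toLocal w) 1) := by
    obtain ⟨x, hx⟩ := hw
    exact Finite.one_lt_card_iff_nontrivial.mpr ⟨⟨x, 0, hx⟩⟩
  have hH' : ∀ v ∈ S, Nat.card (H v) ^ 2 =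
      Nat.card (galoisCohomology ((W.torsionGaloisModule ((p ^ k : ℕ) : ℤ)).toLocal v) 1) := by
    intro v hv; rw [sq]; exact hH v hv
  obtain ⟨c, hc, hc0, hcH⟩ := exists_ne_zero_mem_kummerOutside_places W p k e hμ hadd₁ hadd₂ hgal halt hnondeg hperf hsum
    hcompl hEuler hreal S w hwS hw' H hH'
  have hc' := (mem_kummerOutside_iff W (p ^ k) _ c).mp hc
  refine ⟨c, hc0, fun v hvS hvw ↦ hc' v fun h ↦ ?_, hcH⟩
  rcases Finset.mem_insert.mp h with h | h
  · exact hvw h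
  · exact hvS h

/-- The fact's prime-power case in the fact's `∀`-binder shape: for every number field `K`, `∀ W p k, p.Prime → 0 < k → <body at m = p^k>`.
[cite: McCallumLMS1991, §2 Prop. 2.1] -/
theorem mcCallum1991_prop_2_1_auxiliaryClass_primePow_forall :
    ∀ (W : WeierstrassCurve K) [W.IsElliptic] (p k : ℕ), p.Prime → 0 < k →
    ∀ (w : Place K), (∃ x : galoisCohomology ((W.torsionGaloisModule ((p ^ k : ℕ) : ℤ)).toLocal w) 1, x ≠ 0) →
    ∀ (S : Finset (Place K)), w ∉ S →
    ∀ (H : ∀ v : Place K, AddSubgroup (galoisCohomology ((W.torsionGaloisModule ((p ^ k : ℕ) : ℤ)).toLocal v) 1)),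
      (∀ v ∈ S, Nat.card (H v) * Nat.card (H v) =
        Nat.card (galoisCohomology ((W.torsionGaloisModule ((p ^ k : ℕ) : ℤ)).toLocal v) 1)) →
      ∃ c : galoisCohomology (W.torsionGaloisModule ((p ^ k : ℕ) : ℤ)) 1, c ≠ 0 ∧
        (∀ v : Place K, v ∉ S → v ≠ w →
          galoisCohomology.localization (W.torsionGaloisModule ((p ^ k : ℕ) : ℤ)) v 1 c ∈
            W.kummerSelmerStructure ((p ^ k : ℕ) : ℤ) v) ∧
        (∀ v ∈ S, galoisCohomology.localization (W.torsionGaloisModule ((p ^ k : ℕ) : ℤ)) v 1 c ∈ H v) := by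
  intro W _ p k hp hk w hw S hwS H hH
  haveI : Fact p.Prime := ⟨hp⟩
  exact mcCallum1991_prop_2_1_auxiliaryClass_primePow W p k hk w hw S hwS H hH

end Kummer

end Summit.BirchSwinnertonDyer.BirchSwinnertonDyer.Theorems.GenusExact.AuxiliaryClass

end
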